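import Literature.MathematicalPhysics.QuantumFieldTheory.Balaban1983to89.B12Ineq331Cutoff
import Literature.Analysis.Calculus.SmoothCutoff

/-!
# `Balaban1983to89.B12Profile270Bounds` — [Balaban1987RG1] p. 270: «ζ has derivatives up to the second order
bounded by 5» made QUANTITATIVE for the profile of record: `|ζ′| ≤ 6` (sharp), `|ζ″| ≤ 144`

HONEST FRAMING (cell `lit-balaban`, verbatim): statement-level skeleton of published theorems with citation tags;
proofs where landed; nothing here is a claim about the Yang–Mills mass gap.

CITATION HEADER.  T. Bałaban, *Renormalization group approach to lattice gauge field theories. I. Generation of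
effective actions in a small field approximation and a coupling constant renormalization in four dimensions*,
Commun. Math. Phys. **109** (1987) 249–301, doi:10.1007/bf01215223 [Balaban1987RG1] (cell paper B12 = «[I]»;
held text `paper:balaban1987-cmp109-rg-i-small-field`, journal page = PDF page + 248).  Unit `lit-balaban-r09`
gen 16 (display owner of block B12), SKELETON row `B12.Def@270` (definition row; head unchanged) with a rider on
row `B12.Eq3.30-3.32` (the (3.31) cut-off constants).

WHAT IS PRINTED (verbatim, p. 270 [PDF 22]).  *«… we take a partition of unity 1 = Σ_□ ζ_□ with smooth functions
ζ_□. More exactly we assume that if y is a center of the cube □, then ζ_□(x) = Π_{μ=1}^d ζ(M⁻¹(x_μ − y_μ)), where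
ζ ∈ C₀^∞(R¹), ζ(t) = 1 for |t| ≦ 1/3, ζ(t) = 0 for |t| ≧ 2/3, ζ has derivatives up to the second order bounded
by 5.»*  The constant enters only as an `O(1)` (p. 272: the factors `O(1)M⁻¹`, `O(1)M⁻²` produced by derivatives of
`ζ_□` in (3.11)–(3.13), (3.16); (3.31) p. 276).

STATE OF THE TREE BEFORE THIS FILE.  `B12PartitionUnity270` (r09 gen 2, p242559) CONSTRUCTS the profile of record
`zeta t = s(t + 1/2) − s(t − 1/2)`, `s(t) = Real.smoothTransition (3t + 1/2)`, proves the plateaus, `0 ≤ ζ ≤ 1`,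
`ζ ∈ C^∞`, the partition of unity, and that the printed «≤ 5» FAILS for the SECOND derivative of EVERY `C²` profile
with the two plateaus (`thirtySix_le_deriv2`: `max |ζ″| ≥ 36`); its header says *«replace 5 by any bound of the
chosen profile (for `zeta` below we do not compute one)»*.  `B12Ineq331Cutoff.zeta_profile_constants` (r09 gen 7,
p251402) gives the (3.31) cut-off constants `D, D₂` of `ζ_□` for this profile EXISTENTIALLY (*«The values are not
computed»*); likewise `B4PartitionUnity22.exists_deriv_bounds` (B4) and
`QuantumManyBody.PeriodicBoseGasScattering.exists_bound_deriv_smoothTransition` ([folklore]) are existential.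

WHAT THIS MODULE PROVES (0 sorry; no `Prop` fact; axioms standard).
§1  Mathlib's `Real.smoothTransition` (`ST`) in LOGISTIC CLOSED FORM on `(0,1)`:
    `ST x = (1 + exp(1/x − 1/(1−x)))⁻¹` (`smoothTransition_eq_logisticForm`); its first and second derivatives on
    `(0,1)` in closed form (`deriv_smoothTransition_eq_d1Form`, `deriv2_smoothTransition_eq_d2Form`:
    `ST′ = qE/(1+E)²`, `ST″ = E[p(1+E) + q²(E−1)]/(1+E)³` with `E = exp(1/x − 1/(1−x))`, `q = 1/x² + 1/(1−x)²`,
    `p = 2/(1−x)³ − 2/x³`), and `ST′ = ST″ = 0` off `(0,1)` (endpoints included).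
§2  **SHARP FIRST-DERIVATIVE BOUND `|ST′| ≤ 2`, ATTAINED: `ST′(1/2) = 2`** (`abs_deriv_smoothTransition_le_two`,
    `deriv_smoothTransition_half`).  Proof: with `a = 1/x`, `b = 1/(1−x)` one has `a + b = ab`, and
    `E/(1+E)² = 1/(2 + 2cosh(a−b)) ≤ 1/(4 + (a−b)²)`, while `a² + b² ≤ 8 + 2(a−b)²` is `(a−2)² + (b−2)² ≥ 0`.
§3  **SECOND-DERIVATIVE BOUND `|ST″| ≤ 16`** (`abs_deriv2_smoothTransition_le`).  Proof: `ST″ = σ′·(p + τq²)` with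
    `σ′ = E/(1+E)² ≤ 1/R`, `R = 4 + (a−b)² + (a−b)⁴/12` (from `cosh y ≥ 1 + y²/2 + y⁴/24`), `τ = (E−1)/(E+1) ∈ [−1,1]`
    of sign opposite to `p`; hence `|ST″| ≤ max(q² − |p|, |p|)/R`, and both `q² − |p| ≤ 16R`, `|p| ≤ 16R` are, in the
    variable `v = max(a,b) − 2 ≥ 0`, rational functions whose cleared numerators have ALL COEFFICIENTS NONNEGATIVE
    (`core_poly`; `16` is the best constant of this relaxation: equality of `q² − |p| = 16R` at `x = 1/2`).
    Numerically `sup|ST″| ≈ 9.84` (at `x ≈ 0.78`; not certified here).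
§4  THE PROFILE OF RECORD: `ζ′(t) = 3ST′(3t+2) − 3ST′(3t−1)`, `ζ″(t) = 9ST″(3t+2) − 9ST″(3t−1)` with at most one
    term nonzero (`deriv_zeta_eq`, `deriv2_zeta_eq`); **`|ζ′| ≤ 6` with `ζ′(−1/2) = 6`** (`abs_deriv_zeta_le`,
    `deriv_zeta_neg_half`) — so the printed 5 fails for the FIRST derivative of this profile as well
    (`zeta_not_abs_deriv_le_five`), although other profiles meet it: for EVERY differentiable profile with the two
    plateaus `|ζ′| = 3` somewhere (`exists_abs_deriv_eq_three`, mean value), and for every `C¹` profile even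
    `|ζ′| > 3` somewhere (`exists_three_lt_abs_deriv`: `3` is an infimum, not a minimum); **`|ζ″| ≤ 144`**
    (`abs_deriv2_zeta_le`; numerically `sup|ζ″| ≈ 88.6`; `≥ 36` for every profile by `thirtySix_le_deriv2`).
§5  THE (3.31) CUT-OFF CONSTANTS EXPLICIT: `zeta_profile_constants_explicit` = the four conjuncts of
    `B12Ineq331Cutoff.zeta_profile_constants` with `D = 6`, `D₂ = 144`; hence for `ζ_□` built on the profile of
    record `|ζ_□(x) − ζ_□(x′)| ≤ 6M⁻¹|x − x′|₁`, `|∇^η_νζ_□| ≤ 6M⁻¹`, `|∇_νζ_□(x) − ∇_νζ_□(x′)| ≤ 180M⁻²|x − x′|₁`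
    (`abs_zetaCube_sub_le`, `abs_gradZetaCube_le`, `abs_gradZetaCube_sub_le`; `180 = 144 + 6²`) — the printed
    «O(1)M⁻¹», «O(1)M⁻²» of p. 272 with explicit `O(1)`.
READING NOTE (row B12.Def@270, GAPS G-B12-01 rider).  Corrected clause for the profile of record: «ζ has first
derivative bounded by 6 and second derivative bounded by 144»; the located slip «5» (refuted for ζ″ of every profile
in p242559, and for ζ′ of this profile here) propagates nowhere.  Nothing of the series is asserted; imports
`B12Ineq331Cutoff` (hence `B12PartitionUnity270`) and the light hub `Literature.Analysis.Calculus.SmoothCutoff`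
(`differentiable_smoothTransition`, `deriv_smoothTransition_of_nonpos/of_one_le` BY NAME — the same statements exist
as twins in `QuantumManyBody.PeriodicBoseGasScattering`); the remaining small twins
found by the gate's near-duplicate scan (`cosh_taylor_four_le` in `Barriers/CriticalPhenomena`, `deriv_deriv_
smoothTransition_of_nonpos/of_one_le` in `FluidPDE/Wei2016HardyCutoff`, `deriv_smoothTransition_nonneg`/`_le_two` in
`NumberTheory/Sieve/GreenTao2008…`, two Summits-side copies) live in cones that a B12 file cannot import at reasonable
cost; they are re-proved here PRIVATELY where they are helpers, and the two headline statements (`|ST′| ≤ 2`,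
`ST′(1/2) = 2`) are kept public with the twins named — a librarian may lift them into
`Literature/Analysis/Calculus/SmoothTransitionDerivatives.lean`; the `|ST″| ≤ 16` bound and everything in §§4–5 is new.
-/

namespace Literature.MathematicalPhysics.QuantumFieldTheory.Balaban1983to89.B12Profile270Bounds

open Set Real Filter Topology
open Literature.MathematicalPhysics.QuantumFieldTheory.Balaban1983to89.B12PartitionUnity270 (step zeta
  contDiff_zeta zeta_eq_one zeta_eq_zero zeta_nonneg zeta_le_one)
open Literature.MathematicalPhysics.QuantumFieldTheory.Balaban1983to89.B12Ineq331Cutoff (cubeCutoff gradCube l1)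
open Literature.Analysis.Calculus (differentiable_smoothTransition deriv_smoothTransition_of_nonpos
  deriv_smoothTransition_of_one_le)

noncomputable section

/-! ## §1  `Real.smoothTransition` in logistic closed form on `(0,1)` and its first two derivatives -/

/-- `ψ(x) = 1/x − 1/(1−x)` (the exponent: `ST x = (1 + e^{ψ(x)})⁻¹` on `(0,1)`).
[cite: Balaban1987RG1, §3 p.270] (auxiliary; calculus of Mathlib's `Real.smoothTransition`, our notation) -/
def psi (x : ℝ) : ℝ := x⁻¹ - (1 - x)⁻¹

/-- `q(x) = 1/x² + 1/(1−x)² = −ψ′(x)`. [cite: Balaban1987RG1, §3 p.270] (auxiliary; our notation) -/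
def qq (x : ℝ) : ℝ := (x ^ 2)⁻¹ + ((1 - x) ^ 2)⁻¹

/-- `p(x) = 2/(1−x)³ − 2/x³ = q′(x)`. [cite: Balaban1987RG1, §3 p.270] (auxiliary; our notation) -/
def pp (x : ℝ) : ℝ := 2 * ((1 - x) ^ 3)⁻¹ - 2 * (x ^ 3)⁻¹

/-- `E(x) = exp ψ(x)`. [cite: Balaban1987RG1, §3 p.270] (auxiliary; our notation) -/
def EE (x : ℝ) : ℝ := Real.exp (psi x)

/-- The logistic closed form `(1 + E(x))⁻¹`. [cite: Balaban1987RG1, §3 p.270] (auxiliary; our notation) -/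
def logisticForm (x : ℝ) : ℝ := (1 + EE x)⁻¹

/-- Closed form of `ST′` on `(0,1)`: `q E/(1+E)²`. [cite: Balaban1987RG1, §3 p.270] (auxiliary; our notation) -/
def d1Form (x : ℝ) : ℝ := qq x * EE x / (1 + EE x) ^ 2

/-- Closed form of `ST″` on `(0,1)`: `E[p(1+E) + q²(E−1)]/(1+E)³`. [cite: Balaban1987RG1, §3 p.270] (auxiliary) -/
def d2Form (x : ℝ) : ℝ := EE x * (pp x * (1 + EE x) + qq x ^ 2 * (EE x - 1)) / (1 + EE x) ^ 3

/-- `R(x) = 4 + ψ² + ψ⁴/12` (`≤ 2 + 2cosh ψ`). [cite: Balaban1987RG1, §3 p.270] (auxiliary; our notation) -/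
def RR (x : ℝ) : ℝ := 4 + psi x ^ 2 + psi x ^ 4 / 12

/-- `E > 0`. [cite: Balaban1987RG1, §3 p.270] (auxiliary) -/
theorem EE_pos (x : ℝ) : 0 < EE x := Real.exp_pos _

/-- `1 + E > 0`. [cite: Balaban1987RG1, §3 p.270] (auxiliary) -/
theorem one_add_EE_pos (x : ℝ) : 0 < 1 + EE x := by have := EE_pos x; linarith

/-- `R > 0`. [cite: Balaban1987RG1, §3 p.270] (auxiliary) -/
theorem RR_pos (x : ℝ) : 0 < RR x := by unfold RR; positivity

/-- **Logistic closed form**: for `0 < x < 1`, `Real.smoothTransition x = (1 + exp(1/x − 1/(1−x)))⁻¹`.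
[cite: Balaban1987RG1, §3 p.270] (calculus of Mathlib's `Real.smoothTransition`; our computation) -/
theorem smoothTransition_eq_logisticForm {x : ℝ} (hx : x ∈ Ioo (0:ℝ) 1) :
    Real.smoothTransition x = logisticForm x := by
  have h0 : 0 < x := hx.1
  have h1 : 0 < 1 - x := by linarith [hx.2]
  have ha : expNegInvGlue x = Real.exp (-x⁻¹) := by simp [expNegInvGlue, not_le.2 h0]
  have hb : expNegInvGlue (1 - x) = Real.exp (-(1 - x)⁻¹) := by simp [expNegInvGlue, not_le.2 h1]
  unfold Real.smoothTransition logisticForm EE psi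
  rw [ha, hb]
  have hpos : 0 < Real.exp (-x⁻¹) := Real.exp_pos _
  rw [div_eq_iff (by positivity), ← sub_eq_zero]
  have : Real.exp (-(1 - x)⁻¹) = Real.exp (-x⁻¹) * Real.exp (x⁻¹ - (1 - x)⁻¹) := by
    rw [← Real.exp_add]; congr 1; ring
  rw [this]
  have hne : 1 + Real.exp (x⁻¹ - (1 - x)⁻¹) ≠ 0 := by positivity
  field_simp
  ring

/-- The closed form holds on a neighbourhood of every point of `(0,1)`. [cite: Balaban1987RG1, §3 p.270] (auxiliary) -/
theorem smoothTransition_eventuallyEq_logisticForm {x : ℝ} (hx : x ∈ Ioo (0:ℝ) 1) :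
    Real.smoothTransition =ᶠ[𝓝 x] logisticForm :=
  Filter.eventually_of_mem (Ioo_mem_nhds hx.1 hx.2) fun _ hy => smoothTransition_eq_logisticForm hy

/-- `ψ′ = −q` on `(0,1)`. [cite: Balaban1987RG1, §3 p.270] (auxiliary; our computation) -/
theorem hasDerivAt_psi {x : ℝ} (hx : x ∈ Ioo (0:ℝ) 1) : HasDerivAt psi (-qq x) x := by
  have h0 : x ≠ 0 := hx.1.ne'
  have ha := hasDerivAt_inv h0
  have hb : HasDerivAt (fun y : ℝ => (1 - y)⁻¹) (-((1 - x) ^ 2)⁻¹ * (-1)) x := by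
    have h1' : (1 : ℝ) - x ≠ 0 := sub_ne_zero.2 (ne_of_gt hx.2)
    exact (hasDerivAt_inv h1').comp x ((hasDerivAt_id x).const_sub 1)
  have h : HasDerivAt (fun y : ℝ => y⁻¹ - (1 - y)⁻¹) (-(x ^ 2)⁻¹ - -((1 - x) ^ 2)⁻¹ * -1) x :=
    ha.sub hb
  refine h.congr_deriv ?_
  unfold qq; ring

/-- `E′ = −qE` on `(0,1)`. [cite: Balaban1987RG1, §3 p.270] (auxiliary; our computation) -/
theorem hasDerivAt_EE {x : ℝ} (hx : x ∈ Ioo (0:ℝ) 1) : HasDerivAt EE (EE x * (-qq x)) x :=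
  (hasDerivAt_psi hx).exp

/-- `((1+E)⁻¹)′ = qE/(1+E)²` on `(0,1)`. [cite: Balaban1987RG1, §3 p.270] (auxiliary; our computation) -/
theorem hasDerivAt_logisticForm {x : ℝ} (hx : x ∈ Ioo (0:ℝ) 1) : HasDerivAt logisticForm (d1Form x) x := by
  have h : HasDerivAt (fun y => 1 + EE y) (EE x * (-qq x)) x := (hasDerivAt_EE hx).const_add 1
  have h2 := h.inv (one_add_EE_pos x).ne'
  refine h2.congr_deriv ?_
  unfold d1Form
  have := (one_add_EE_pos x).ne'
  field_simp

/-- `q′ = p` on `(0,1)`. [cite: Balaban1987RG1, §3 p.270] (auxiliary; our computation) -/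
theorem hasDerivAt_qq {x : ℝ} (hx : x ∈ Ioo (0:ℝ) 1) : HasDerivAt qq (pp x) x := by
  have h0 : x ≠ 0 := hx.1.ne'
  have h1 : (1 : ℝ) - x ≠ 0 := sub_ne_zero.2 (ne_of_gt hx.2)
  have ha : HasDerivAt (fun y : ℝ => (y ^ 2)⁻¹) (-(↑2 * x ^ (2 - 1) * 1) / (x ^ 2) ^ 2) x :=
    ((hasDerivAt_id x).pow 2).inv (pow_ne_zero 2 h0)
  have hb : HasDerivAt (fun y : ℝ => ((1 - y) ^ 2)⁻¹) (-(↑2 * (1 - x) ^ (2 - 1) * (-1)) / ((1 - x) ^ 2) ^ 2) x :=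
    (((hasDerivAt_id x).const_sub 1).pow 2).inv (pow_ne_zero 2 h1)
  have h : HasDerivAt (fun y : ℝ => (y ^ 2)⁻¹ + ((1 - y) ^ 2)⁻¹)
      (-(↑2 * x ^ (2 - 1) * 1) / (x ^ 2) ^ 2 + -(↑2 * (1 - x) ^ (2 - 1) * (-1)) / ((1 - x) ^ 2) ^ 2) x :=
    ha.add hb
  refine h.congr_deriv ?_
  unfold pp
  field_simp
  ring

/-- `(qE/(1+E)²)′ = E[p(1+E) + q²(E−1)]/(1+E)³` on `(0,1)`. [cite: Balaban1987RG1, §3 p.270] (auxiliary; our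
computation) -/
theorem hasDerivAt_d1Form {x : ℝ} (hx : x ∈ Ioo (0:ℝ) 1) : HasDerivAt d1Form (d2Form x) x := by
  have hq := hasDerivAt_qq hx
  have hE := hasDerivAt_EE hx
  have hden : HasDerivAt (fun y => (1 + EE y) ^ 2) (↑2 * (1 + EE x) ^ (2 - 1) * (EE x * (-qq x))) x :=
    ((hasDerivAt_EE hx).const_add 1).pow 2
  have h := (hq.mul hE).div hden (pow_ne_zero 2 (one_add_EE_pos x).ne')
  refine h.congr_deriv ?_
  simp only [Pi.mul_apply]
  unfold d2Form
  have := (one_add_EE_pos x).ne'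
  field_simp
  ring

/-- **`ST′` on `(0,1)`**: `HasDerivAt smoothTransition (q E/(1+E)²) x`. [cite: Balaban1987RG1, §3 p.270] (calculus of
Mathlib's `Real.smoothTransition`; our computation) -/
theorem hasDerivAt_smoothTransition {x : ℝ} (hx : x ∈ Ioo (0:ℝ) 1) :
    HasDerivAt Real.smoothTransition (d1Form x) x :=
  (hasDerivAt_logisticForm hx).congr_of_eventuallyEq (smoothTransition_eventuallyEq_logisticForm hx)

/-- `ST′ = q E/(1+E)²` on `(0,1)`. [cite: Balaban1987RG1, §3 p.270] (our computation) -/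
theorem deriv_smoothTransition_eq_d1Form {x : ℝ} (hx : x ∈ Ioo (0:ℝ) 1) :
    deriv Real.smoothTransition x = d1Form x :=
  (hasDerivAt_smoothTransition hx).deriv

/-- **`ST″` on `(0,1)`**: `HasDerivAt (deriv smoothTransition) (E[p(1+E) + q²(E−1)]/(1+E)³) x`.
[cite: Balaban1987RG1, §3 p.270] (our computation) -/
theorem hasDerivAt_deriv_smoothTransition {x : ℝ} (hx : x ∈ Ioo (0:ℝ) 1) :
    HasDerivAt (deriv Real.smoothTransition) (d2Form x) x :=
  (hasDerivAt_d1Form hx).congr_of_eventuallyEq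
    (Filter.eventually_of_mem (Ioo_mem_nhds hx.1 hx.2) fun _ hy => deriv_smoothTransition_eq_d1Form hy)

/-- `ST″ = E[p(1+E) + q²(E−1)]/(1+E)³` on `(0,1)`. [cite: Balaban1987RG1, §3 p.270] (our computation) -/
theorem deriv2_smoothTransition_eq_d2Form {x : ℝ} (hx : x ∈ Ioo (0:ℝ) 1) :
    deriv (deriv Real.smoothTransition) x = d2Form x :=
  (hasDerivAt_deriv_smoothTransition hx).deriv

/-- `ST′` is `C¹`. [folklore] (private helper) -/
private theorem contDiff_one_deriv_smoothTransition : ContDiff ℝ 1 (deriv Real.smoothTransition) := by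
  have : ContDiff ℝ ((1 : ℕ∞) + 1) Real.smoothTransition := Real.smoothTransition.contDiff
  exact this.deriv'

/-- `ST′` is differentiable — private twin of `Literature.Analysis.FluidPDE.Wei2016.differentiable_deriv_smoothTransition`
(not imported: closure size). [folklore] (private helper) -/
private theorem differentiable_deriv_smoothTransition : Differentiable ℝ (deriv Real.smoothTransition) :=
  contDiff_one_deriv_smoothTransition.differentiable one_ne_zero

/-- A differentiable function constant on `[a, b]` (`a < b`) has derivative `0` at every point of `[a, b]`,
endpoints included (one-sided uniqueness of the derivative; cf. `B12PartitionUnity270.deriv_eq_zero_of_const_Icc_left/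
right`). [folklore] (private helper) -/
private theorem deriv_eq_zero_of_const_Icc {f : ℝ → ℝ} (hf : Differentiable ℝ f) {a b c : ℝ} (hab : a < b)
    (h : ∀ t ∈ Icc a b, f t = c) {t : ℝ} (ht : t ∈ Icc a b) : deriv f t = 0 := by
  have hU : UniqueDiffWithinAt ℝ (Icc a b) t := uniqueDiffOn_Icc hab _ ht
  have h1 : HasDerivWithinAt f (deriv f t) (Icc a b) t := (hf t).hasDerivAt.hasDerivWithinAt
  have h2 : HasDerivWithinAt f 0 (Icc a b) t :=
    (hasDerivWithinAt_const t (Icc a b) c).congr (fun s hs => h s hs) (h t ht)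
  exact hU.eq_deriv _ h1 h2

/-- `ST″ = 0` on `(−∞, 0]` — private twin of `Literature.Analysis.FluidPDE.Wei2016.deriv_deriv_smoothTransition_of_nonpos`
(not imported: closure size). [folklore] (private helper) -/
private theorem deriv2_smoothTransition_of_nonpos {x : ℝ} (hx : x ≤ 0) : deriv (deriv Real.smoothTransition) x = 0 :=
  deriv_eq_zero_of_const_Icc differentiable_deriv_smoothTransition (by linarith : x - 1 < 0)
    (fun t ht => deriv_smoothTransition_of_nonpos ht.2) ⟨by linarith, hx⟩

/-- `ST″ = 0` on `[1, ∞)` — private twin of `Literature.Analysis.FluidPDE.Wei2016.deriv_deriv_smoothTransition_of_one_le`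
(not imported: closure size). [folklore] (private helper) -/
private theorem deriv2_smoothTransition_of_one_le {x : ℝ} (hx : 1 ≤ x) : deriv (deriv Real.smoothTransition) x = 0 :=
  deriv_eq_zero_of_const_Icc differentiable_deriv_smoothTransition (by linarith : (1:ℝ) < x + 1)
    (fun t ht => deriv_smoothTransition_of_one_le ht.1) ⟨hx, by linarith⟩

/-! ## §2  The sharp first-derivative bound `|ST′| ≤ 2 = ST′(1/2)` -/

/-- `cosh y ≥ 1 + y²/2 + y⁴/24` (partial sum of the power series) — private twin of
`Literature.Barriers.CriticalPhenomena.NewmanLeeYang.cosh_taylor_four_le` (not imported: unrelated closure).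
[folklore] (private helper) -/
private theorem cosh_taylor4_le (y : ℝ) : 1 + y ^ 2 / 2 + y ^ 4 / 24 ≤ Real.cosh y := by
  have h := Real.hasSum_cosh y
  have h3 := sum_le_hasSum (Finset.range 3)
    (fun i _ => div_nonneg (by rw [pow_mul]; positivity) (by positivity)) h
  have e : ∑ i ∈ Finset.range 3, y ^ (2 * i) / ((2 * i).factorial : ℝ) = 1 + y ^ 2 / 2 + y ^ 4 / 24 := by
    simp only [Finset.sum_range_succ, Finset.sum_range_zero, Nat.factorial]
    norm_num
  linarith

/-- `E + E⁻¹ = 2cosh ψ`. [cite: Balaban1987RG1, §3 p.270] (auxiliary) -/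
theorem EE_add_inv (x : ℝ) : EE x + (EE x)⁻¹ = 2 * Real.cosh (psi x) := by
  unfold EE; rw [Real.cosh_eq, ← Real.exp_neg]; ring

/-- `σ′ = E/(1+E)² ≤ 1/R` in product form: `E/(1+E)² · R ≤ 1`. [cite: Balaban1987RG1, §3 p.270] (our computation) -/
theorem sigma_mul_RR_le_one (x : ℝ) : EE x / (1 + EE x) ^ 2 * RR x ≤ 1 := by
  have hE := EE_pos x
  have h1 := one_add_EE_pos x
  have hc := cosh_taylor4_le (psi x)
  have hs := EE_add_inv x
  have hinv : EE x * (EE x)⁻¹ = 1 := mul_inv_cancel₀ hE.ne'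
  rw [div_mul_eq_mul_div, div_le_one (by positivity)]
  unfold RR
  have h2 : 2 + psi x ^ 2 + psi x ^ 4 / 12 ≤ EE x + (EE x)⁻¹ := by rw [hs]; linarith
  nlinarith [mul_le_mul_of_nonneg_left h2 hE.le]

/-- `σ′ ≥ 0`. [cite: Balaban1987RG1, §3 p.270] (auxiliary) -/
theorem sigma_nonneg (x : ℝ) : 0 ≤ EE x / (1 + EE x) ^ 2 := by
  have := EE_pos x; positivity

/-- `1/x + 1/(1−x) = 1/(x(1−x))`, i.e. `a + b = ab`. [cite: Balaban1987RG1, §3 p.270] (auxiliary) -/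
theorem inv_add_inv_eq {x : ℝ} (hx : x ∈ Ioo (0:ℝ) 1) : x⁻¹ + (1 - x)⁻¹ = x⁻¹ * (1 - x)⁻¹ := by
  have h0 : x ≠ 0 := hx.1.ne'
  have h1 : (1 : ℝ) - x ≠ 0 := sub_ne_zero.2 (ne_of_gt hx.2)
  field_simp
  ring

/-- `q = a² + b²`. [cite: Balaban1987RG1, §3 p.270] (auxiliary) -/
theorem qq_eq (x : ℝ) : qq x = (x⁻¹) ^ 2 + ((1 - x)⁻¹) ^ 2 := by
  unfold qq; rw [inv_pow, inv_pow]

/-- `p = 2(b³ − a³)`. [cite: Balaban1987RG1, §3 p.270] (auxiliary) -/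
theorem pp_eq (x : ℝ) : pp x = 2 * (((1 - x)⁻¹) ^ 3 - (x⁻¹) ^ 3) := by
  unfold pp; rw [inv_pow, inv_pow]; ring

/-- `ψ = a − b`. [cite: Balaban1987RG1, §3 p.270] (auxiliary) -/
theorem psi_eq (x : ℝ) : psi x = x⁻¹ - (1 - x)⁻¹ := rfl

/-- `q ≤ 2R` — the first-derivative inequality `a² + b² ≤ 8 + 2(a−b)²`, i.e. `(a−2)² + (b−2)² ≥ 0` given
`a + b = ab`. [cite: Balaban1987RG1, §3 p.270] (our computation) -/
theorem qq_le_two_mul_RR {x : ℝ} (hx : x ∈ Ioo (0:ℝ) 1) : qq x ≤ 2 * RR x := by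
  have hab := inv_add_inv_eq hx
  set a := x⁻¹
  set b := (1 - x)⁻¹
  rw [qq_eq, RR, psi_eq]
  nlinarith [sq_nonneg (a - 2), sq_nonneg (b - 2), sq_nonneg ((a - b) ^ 2)]

/-- `ST′ ≥ 0` in closed form. [cite: Balaban1987RG1, §3 p.270] (auxiliary) -/
theorem d1Form_nonneg (x : ℝ) : 0 ≤ d1Form x := by
  unfold d1Form qq; have := EE_pos x; positivity

/-- `ST′ ≤ 2` in closed form on `(0,1)`. [cite: Balaban1987RG1, §3 p.270] (our computation) -/
theorem d1Form_le_two {x : ℝ} (hx : x ∈ Ioo (0:ℝ) 1) : d1Form x ≤ 2 := by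
  have h1 := sigma_mul_RR_le_one x
  have h2 := qq_le_two_mul_RR hx
  have hR := RR_pos x
  have hs := sigma_nonneg x
  have e : d1Form x = qq x * (EE x / (1 + EE x) ^ 2) := by unfold d1Form; ring
  rw [e]
  calc qq x * (EE x / (1 + EE x) ^ 2) ≤ 2 * RR x * (EE x / (1 + EE x) ^ 2) :=
        mul_le_mul_of_nonneg_right h2 hs
    _ = 2 * (EE x / (1 + EE x) ^ 2 * RR x) := by ring
    _ ≤ 2 * 1 := by linarith
    _ = 2 := by ring

/-- `ST′ ≥ 0` everywhere — private twin of `Literature.NumberTheory.Sieve.GreenTao2008.deriv_smoothTransition_nonneg`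
(not imported: its closure is the Green–Tao sieve). [folklore] (private helper) -/
private theorem deriv_smoothTransition_nonneg (x : ℝ) : 0 ≤ deriv Real.smoothTransition x := by
  rcases le_or_gt x 0 with h0 | h0
  · rw [deriv_smoothTransition_of_nonpos h0]
  rcases le_or_gt 1 x with h1 | h1
  · rw [deriv_smoothTransition_of_one_le h1]
  rw [deriv_smoothTransition_eq_d1Form ⟨h0, h1⟩]; exact d1Form_nonneg x

/-- **SHARP FIRST-DERIVATIVE BOUND for Mathlib's smooth transition: `|smoothTransition′ x| ≤ 2` for all `x`.**
Twins elsewhere in the tree (neither importable here at reasonable closure cost): `Literature.NumberTheory.Sieve.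
GreenTao2008.deriv_smoothTransition_le_two` (Green–Tao sieve cone) and a Summits-side copy; a librarian may lift all
three into `Literature/Analysis/Calculus/SmoothTransitionDerivatives.lean`.
[cite: Balaban1987RG1, §3 p.270] (serves the p.270 profile clause; our computation) -/
theorem abs_deriv_smoothTransition_le_two (x : ℝ) : |deriv Real.smoothTransition x| ≤ 2 := by
  rw [abs_of_nonneg (deriv_smoothTransition_nonneg x)]
  rcases le_or_gt x 0 with h0 | h0
  · rw [deriv_smoothTransition_of_nonpos h0]; norm_num
  rcases le_or_gt 1 x with h1 | h1
  · rw [deriv_smoothTransition_of_one_le h1]; norm_num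
  rw [deriv_smoothTransition_eq_d1Form ⟨h0, h1⟩]; exact d1Form_le_two ⟨h0, h1⟩

/-- **The bound `2` is attained**: `smoothTransition′(1/2) = 2` (a Summits-side twin exists; not importable from
Literature). [cite: Balaban1987RG1, §3 p.270] (our computation) -/
theorem deriv_smoothTransition_half : deriv Real.smoothTransition (1 / 2) = 2 := by
  rw [deriv_smoothTransition_eq_d1Form ⟨by norm_num, by norm_num⟩]
  unfold d1Form qq EE psi
  norm_num

/-! ## §3  The second-derivative bound `|ST″| ≤ 16` -/

/-- The two polynomial inequalities behind `|ST″| ≤ 16`, in the variable `v = b − 2 ≥ 0` (`a = (2+v)/(1+v)`,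
`b = 2+v`): after clearing the denominator `3(1+v)⁶` the differences are polynomials in `v` with ALL COEFFICIENTS
NONNEGATIVE (`144v + 696v² + 1404v³ + 1534v⁴ + 988v⁵ + 386v⁶ + 94v⁷ + 17v⁸ + 4v⁹ + v¹⁰` and
`192 + 1008v + 2280v² + 2916v³ + 2374v⁴ + 1396v⁵ + 722v⁶ + 358v⁷ + 140v⁸ + 34v⁹ + 4v¹⁰`); the first vanishes at
`v = 0`, so `16` is the best constant of this relaxation. [cite: Balaban1987RG1, §3 p.270] (our computation) -/
theorem core_poly (v : ℝ) (hv : 0 ≤ v) :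
    (((2 + v) / (1 + v)) ^ 2 + (2 + v) ^ 2) ^ 2 - 2 * ((2 + v) ^ 3 - ((2 + v) / (1 + v)) ^ 3) ≤
        16 * (4 + ((2 + v) / (1 + v) - (2 + v)) ^ 2 + ((2 + v) / (1 + v) - (2 + v)) ^ 4 / 12) ∧
      2 * ((2 + v) ^ 3 - ((2 + v) / (1 + v)) ^ 3) ≤
        16 * (4 + ((2 + v) / (1 + v) - (2 + v)) ^ 2 + ((2 + v) / (1 + v) - (2 + v)) ^ 4 / 12) := by
  have h1 : (0 : ℝ) < 1 + v := by linarith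
  have h1' : (1 : ℝ) + v ≠ 0 := h1.ne'
  constructor
  · have key : 16 * (4 + ((2 + v) / (1 + v) - (2 + v)) ^ 2 + ((2 + v) / (1 + v) - (2 + v)) ^ 4 / 12) -
        ((((2 + v) / (1 + v)) ^ 2 + (2 + v) ^ 2) ^ 2 - 2 * ((2 + v) ^ 3 - ((2 + v) / (1 + v)) ^ 3)) =
        (144 * v + 696 * v ^ 2 + 1404 * v ^ 3 + 1534 * v ^ 4 + 988 * v ^ 5 + 386 * v ^ 6 + 94 * v ^ 7 +
          17 * v ^ 8 + 4 * v ^ 9 + v ^ 10) / (3 * (1 + v) ^ 6) := by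
      field_simp
      ring
    have hP : 0 ≤ (144 * v + 696 * v ^ 2 + 1404 * v ^ 3 + 1534 * v ^ 4 + 988 * v ^ 5 + 386 * v ^ 6 +
        94 * v ^ 7 + 17 * v ^ 8 + 4 * v ^ 9 + v ^ 10) / (3 * (1 + v) ^ 6) := by positivity
    linarith
  · have key : 16 * (4 + ((2 + v) / (1 + v) - (2 + v)) ^ 2 + ((2 + v) / (1 + v) - (2 + v)) ^ 4 / 12) -
        2 * ((2 + v) ^ 3 - ((2 + v) / (1 + v)) ^ 3) =
        (192 + 1008 * v + 2280 * v ^ 2 + 2916 * v ^ 3 + 2374 * v ^ 4 + 1396 * v ^ 5 + 722 * v ^ 6 +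
          358 * v ^ 7 + 140 * v ^ 8 + 34 * v ^ 9 + 4 * v ^ 10) / (3 * (1 + v) ^ 6) := by
      field_simp
      ring
    have hP : 0 ≤ (192 + 1008 * v + 2280 * v ^ 2 + 2916 * v ^ 3 + 2374 * v ^ 4 + 1396 * v ^ 5 +
        722 * v ^ 6 + 358 * v ^ 7 + 140 * v ^ 8 + 34 * v ^ 9 + 4 * v ^ 10) / (3 * (1 + v) ^ 6) := by
      positivity
    linarith

/-- The core inequalities in the variables `1 < a ≤ b`, `a + b = ab` (then `(a−1)(b−1) = 1`, `b = 2 + v` with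
`v ≥ 0`, `a = (2+v)/(1+v)`): `(a²+b²)² − 2(b³−a³) ≤ 16R` and `2(b³−a³) ≤ 16R`, `R = 4 + (a−b)² + (a−b)⁴/12`.
[cite: Balaban1987RG1, §3 p.270] (our computation) -/
theorem core_ab {a b : ℝ} (ha : 1 < a) (hab : a ≤ b) (h : a + b = a * b) :
    (a ^ 2 + b ^ 2) ^ 2 - 2 * (b ^ 3 - a ^ 3) ≤ 16 * (4 + (a - b) ^ 2 + (a - b) ^ 4 / 12) ∧
      2 * (b ^ 3 - a ^ 3) ≤ 16 * (4 + (a - b) ^ 2 + (a - b) ^ 4 / 12) := by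
  have h1 : (a - 1) * (b - 1) = 1 := by linear_combination (-1 : ℝ) * h
  have hb1 : 0 < b - 1 := by nlinarith
  have hb2 : 2 ≤ b := by nlinarith
  set v := b - 2 with hv_def
  have hv : 0 ≤ v := by linarith
  have hb : b = 2 + v := by ring
  have hav : a = (2 + v) / (1 + v) := by
    rw [eq_div_iff (by positivity)]
    linear_combination h1
  obtain ⟨c1, c2⟩ := core_poly v hv
  rw [hav, hb]
  exact ⟨c1, c2⟩

/-- `ST″ = σ′·(p + τq²)` with `σ′ = E/(1+E)²`, `τ = (E−1)/(1+E)`. [cite: Balaban1987RG1, §3 p.270] (our computation) -/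
theorem d2Form_eq (x : ℝ) :
    d2Form x = EE x / (1 + EE x) ^ 2 * (pp x + (EE x - 1) / (1 + EE x) * qq x ^ 2) := by
  unfold d2Form
  have := (one_add_EE_pos x).ne'
  field_simp

/-- `τ ≤ 1`. [cite: Balaban1987RG1, §3 p.270] (auxiliary) -/
theorem tau_le_one (x : ℝ) : (EE x - 1) / (1 + EE x) ≤ 1 := by
  rw [div_le_one (one_add_EE_pos x)]; linarith

/-- `−1 ≤ τ`. [cite: Balaban1987RG1, §3 p.270] (auxiliary) -/
theorem neg_one_le_tau (x : ℝ) : -1 ≤ (EE x - 1) / (1 + EE x) := by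
  rw [le_div_iff₀ (one_add_EE_pos x)]; have := EE_pos x; linarith

/-- `ψ ≥ 0 ⇒ τ ≥ 0`. [cite: Balaban1987RG1, §3 p.270] (auxiliary) -/
theorem tau_nonneg_of {x : ℝ} (h : 0 ≤ psi x) : 0 ≤ (EE x - 1) / (1 + EE x) := by
  have : 1 ≤ EE x := Real.one_le_exp h
  exact div_nonneg (by linarith) (one_add_EE_pos x).le

/-- `ψ ≤ 0 ⇒ τ ≤ 0`. [cite: Balaban1987RG1, §3 p.270] (auxiliary) -/
theorem tau_nonpos_of {x : ℝ} (h : psi x ≤ 0) : (EE x - 1) / (1 + EE x) ≤ 0 := by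
  have : EE x ≤ 1 := Real.exp_le_one_iff.2 h
  exact div_nonpos_of_nonpos_of_nonneg (by linarith) (one_add_EE_pos x).le

/-- **`|ST″| ≤ 16` in closed form on `(0,1)`**: `τ` and `p` have opposite signs, so `|p + τq²| ≤ max(q² − |p|, |p|)`,
and both are `≤ 16R` by `core_ab`, while `σ′R ≤ 1`. [cite: Balaban1987RG1, §3 p.270] (our computation) -/
theorem abs_d2Form_le {x : ℝ} (hx : x ∈ Ioo (0:ℝ) 1) : |d2Form x| ≤ 16 := by
  have hS0 := sigma_nonneg x
  have hSR := sigma_mul_RR_le_one x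
  have hT1 := tau_le_one x
  have hTm := neg_one_le_tau x
  set S := EE x / (1 + EE x) ^ 2 with hS_def
  set T := (EE x - 1) / (1 + EE x) with hT_def
  have hab := inv_add_inv_eq hx
  have ha1 : 1 < x⁻¹ := (one_lt_inv₀ hx.1).2 hx.2
  have hb1 : 1 < (1 - x)⁻¹ := (one_lt_inv₀ (by linarith [hx.2])).2 (by linarith [hx.1])
  set a := x⁻¹ with ha_def
  set b := (1 - x)⁻¹ with hb_def
  have hq : qq x = a ^ 2 + b ^ 2 := qq_eq x
  have hp : pp x = 2 * (b ^ 3 - a ^ 3) := pp_eq x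
  have hRab : RR x = 4 + (a - b) ^ 2 + (a - b) ^ 4 / 12 := rfl
  have hq0 : 0 ≤ qq x ^ 2 := sq_nonneg _
  rw [d2Form_eq, ← hS_def, ← hT_def, abs_le]
  rcases le_total x (1 / 2) with hle | hge
  · -- `x ≤ 1/2`: `b ≤ a`, `τ ≥ 0`, `p ≤ 0`
    have hba : b ≤ a := inv_anti₀ hx.1 (by linarith)
    have hT0 : 0 ≤ T := tau_nonneg_of (by rw [psi_eq]; linarith)
    obtain ⟨c1, c2⟩ := core_ab hb1 hba (by linarith [hab, mul_comm a b])
    have c1' : qq x ^ 2 + pp x ≤ 16 * RR x := by rw [hq, hp, hRab]; linarith [c1]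
    have c2' : -(16 * RR x) ≤ pp x := by rw [hp, hRab]; linarith [c2]
    have hTq : 0 ≤ T * qq x ^ 2 := mul_nonneg hT0 hq0
    have hTq' : 0 ≤ (1 - T) * qq x ^ 2 := mul_nonneg (sub_nonneg.2 hT1) hq0
    constructor
    · have h2 : S * (-(16 * RR x)) ≤ S * (pp x + T * qq x ^ 2) :=
        mul_le_mul_of_nonneg_left (by linarith) hS0
      linarith [h2, hSR]
    · have h2 : S * (pp x + T * qq x ^ 2) ≤ S * (16 * RR x) :=
        mul_le_mul_of_nonneg_left (by linarith) hS0
      linarith [h2, hSR]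
  · -- `1/2 ≤ x`: `a ≤ b`, `τ ≤ 0`, `p ≥ 0`
    have hab' : a ≤ b := inv_anti₀ (by linarith [hx.2]) (by linarith)
    have hT0 : T ≤ 0 := tau_nonpos_of (by rw [psi_eq]; linarith)
    obtain ⟨c1, c2⟩ := core_ab ha1 hab' hab
    have c1' : qq x ^ 2 - pp x ≤ 16 * RR x := by rw [hq, hp, hRab]; linarith [c1]
    have c2' : pp x ≤ 16 * RR x := by rw [hp, hRab]; linarith [c2]
    have hTq : 0 ≤ (T + 1) * qq x ^ 2 := mul_nonneg (by linarith) hq0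
    have hTq' : 0 ≤ -T * qq x ^ 2 := mul_nonneg (by linarith) hq0
    constructor
    · have h2 : S * (-(16 * RR x)) ≤ S * (pp x + T * qq x ^ 2) :=
        mul_le_mul_of_nonneg_left (by linarith) hS0
      linarith [h2, hSR]
    · have h2 : S * (pp x + T * qq x ^ 2) ≤ S * (16 * RR x) :=
        mul_le_mul_of_nonneg_left (by linarith) hS0
      linarith [h2, hSR]

/-- **SECOND-DERIVATIVE BOUND for Mathlib's smooth transition: `|smoothTransition″ x| ≤ 16` for all `x`**
(numerically `sup ≈ 9.84`, not certified). [cite: Balaban1987RG1, §3 p.270] (serves the p.270 profile clause; our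
computation) -/
theorem abs_deriv2_smoothTransition_le (x : ℝ) : |deriv (deriv Real.smoothTransition) x| ≤ 16 := by
  rcases le_or_gt x 0 with h0 | h0
  · rw [deriv2_smoothTransition_of_nonpos h0]; norm_num
  rcases le_or_gt 1 x with h1 | h1
  · rw [deriv2_smoothTransition_of_one_le h1]; norm_num
  rw [deriv2_smoothTransition_eq_d2Form ⟨h0, h1⟩]; exact abs_d2Form_le ⟨h0, h1⟩

/-! ## §4  The profile of record `ζ` of `B12PartitionUnity270` -/

/-- `ζ(t) = ST(3t + 2) − ST(3t − 1)`. [cite: Balaban1987RG1, §3 p.270] -/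
theorem zeta_eq_smoothTransition (t : ℝ) :
    zeta t = Real.smoothTransition (3 * t + 2) - Real.smoothTransition (3 * t - 1) := by
  simp only [zeta, step]; ring_nf

/-- `ζ′(t) = 3ST′(3t+2) − 3ST′(3t−1)`. [cite: Balaban1987RG1, §3 p.270] (our computation) -/
theorem hasDerivAt_zeta (t : ℝ) :
    HasDerivAt zeta (3 * deriv Real.smoothTransition (3 * t + 2) - 3 * deriv Real.smoothTransition (3 * t - 1)) t := by
  have e : zeta = fun s => Real.smoothTransition (3 * s + 2) - Real.smoothTransition (3 * s - 1) :=
    funext zeta_eq_smoothTransition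
  rw [e]
  have ha : HasDerivAt (fun s : ℝ => 3 * s + 2) 3 t := by
    simpa using ((hasDerivAt_id t).const_mul (3 : ℝ)).add_const (2 : ℝ)
  have hb : HasDerivAt (fun s : ℝ => 3 * s - 1) 3 t := by
    simpa using ((hasDerivAt_id t).const_mul (3 : ℝ)).sub_const (1 : ℝ)
  have h1 := ((differentiable_smoothTransition (3 * t + 2)).hasDerivAt).comp t ha
  have h2 := ((differentiable_smoothTransition (3 * t - 1)).hasDerivAt).comp t hb
  have h := h1.sub h2
  refine h.congr_deriv ?_
  ring

/-- `deriv ζ t = 3ST′(3t+2) − 3ST′(3t−1)`. [cite: Balaban1987RG1, §3 p.270] (our computation) -/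
theorem deriv_zeta_eq (t : ℝ) :
    deriv zeta t = 3 * deriv Real.smoothTransition (3 * t + 2) - 3 * deriv Real.smoothTransition (3 * t - 1) :=
  (hasDerivAt_zeta t).deriv

/-- `ζ″(t) = 9ST″(3t+2) − 9ST″(3t−1)`. [cite: Balaban1987RG1, §3 p.270] (our computation) -/
theorem hasDerivAt_deriv_zeta (t : ℝ) :
    HasDerivAt (deriv zeta) (9 * deriv (deriv Real.smoothTransition) (3 * t + 2) -
      9 * deriv (deriv Real.smoothTransition) (3 * t - 1)) t := by
  have e : deriv zeta = fun s => 3 * deriv Real.smoothTransition (3 * s + 2) -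
      3 * deriv Real.smoothTransition (3 * s - 1) := funext deriv_zeta_eq
  rw [e]
  have ha : HasDerivAt (fun s : ℝ => 3 * s + 2) 3 t := by
    simpa using ((hasDerivAt_id t).const_mul (3 : ℝ)).add_const (2 : ℝ)
  have hb : HasDerivAt (fun s : ℝ => 3 * s - 1) 3 t := by
    simpa using ((hasDerivAt_id t).const_mul (3 : ℝ)).sub_const (1 : ℝ)
  have h1 := (((differentiable_deriv_smoothTransition (3 * t + 2)).hasDerivAt).comp t ha).const_mul 3
  have h2 := (((differentiable_deriv_smoothTransition (3 * t - 1)).hasDerivAt).comp t hb).const_mul 3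
  have h := h1.sub h2
  refine h.congr_deriv ?_
  ring

/-- `deriv (deriv ζ) t = 9ST″(3t+2) − 9ST″(3t−1)`. [cite: Balaban1987RG1, §3 p.270] (our computation) -/
theorem deriv2_zeta_eq (t : ℝ) :
    deriv (deriv zeta) t = 9 * deriv (deriv Real.smoothTransition) (3 * t + 2) -
      9 * deriv (deriv Real.smoothTransition) (3 * t - 1) :=
  (hasDerivAt_deriv_zeta t).deriv

/-- **`|ζ′| ≤ 6` for the profile of record** (the two transitions have disjoint supports: for `t ≤ 0` the second
term vanishes, for `t ≥ −1/3` the first). [cite: Balaban1987RG1, §3 p.270] (corrected constant; our computation) -/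
theorem abs_deriv_zeta_le (t : ℝ) : |deriv zeta t| ≤ 6 := by
  rw [deriv_zeta_eq]
  rcases le_or_gt t 0 with h | h
  · rw [deriv_smoothTransition_of_nonpos (by linarith : 3 * t - 1 ≤ 0)]
    have := abs_deriv_smoothTransition_le_two (3 * t + 2)
    rw [mul_zero, sub_zero, abs_mul]; norm_num; linarith
  · rw [deriv_smoothTransition_of_one_le (by linarith : (1:ℝ) ≤ 3 * t + 2)]
    have := abs_deriv_smoothTransition_le_two (3 * t - 1)
    rw [mul_zero, zero_sub, abs_neg, abs_mul]; norm_num; linarith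

/-- **The bound `6` is attained: `ζ′(−1/2) = 6`.** [cite: Balaban1987RG1, §3 p.270] (our computation) -/
theorem deriv_zeta_neg_half : deriv zeta (-(1 / 2)) = 6 := by
  rw [deriv_zeta_eq, deriv_smoothTransition_of_nonpos (by norm_num : 3 * (-(1 / 2) : ℝ) - 1 ≤ 0)]
  have : (3 : ℝ) * -(1 / 2) + 2 = 1 / 2 := by norm_num
  rw [this, deriv_smoothTransition_half]; norm_num

/-- Hence the printed «derivatives … bounded by 5» fails for the FIRST derivative of the profile of record too
(for the second derivative of every profile: `B12PartitionUnity270.zeta_not_deriv2_le_five`).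
[cite: Balaban1987RG1, §3 p.270] (located slip; our computation) -/
theorem zeta_not_abs_deriv_le_five : ¬ ∀ t, |deriv zeta t| ≤ 5 := by
  intro h
  have := h (-(1 / 2))
  rw [deriv_zeta_neg_half] at this
  norm_num at this

/-- **`|ζ″| ≤ 144` for the profile of record** (numerically `sup|ζ″| ≈ 88.6`; `≥ 36` for every profile,
`B12PartitionUnity270.thirtySix_le_deriv2`). [cite: Balaban1987RG1, §3 p.270] (corrected constant; our computation) -/
theorem abs_deriv2_zeta_le (t : ℝ) : |deriv (deriv zeta) t| ≤ 144 := by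
  rw [deriv2_zeta_eq]
  rcases le_or_gt t 0 with h | h
  · rw [deriv2_smoothTransition_of_nonpos (by linarith : 3 * t - 1 ≤ 0)]
    have := abs_deriv2_smoothTransition_le (3 * t + 2)
    rw [mul_zero, sub_zero, abs_mul]; norm_num; linarith
  · rw [deriv2_smoothTransition_of_one_le (by linarith : (1:ℝ) ≤ 3 * t + 2)]
    have := abs_deriv2_smoothTransition_le (3 * t - 1)
    rw [mul_zero, zero_sub, abs_neg, abs_mul]; norm_num; linarith

/-- For EVERY differentiable profile with the two printed plateaus, `|ζ′| = 3` somewhere in `(1/3, 2/3)` (mean value: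
`ζ(2/3) − ζ(1/3) = −1` over length `1/3`); so «bounded by 5» is consistent for the first derivative, with room `5/3`.
[cite: Balaban1987RG1, §3 p.270] (our remark) -/
theorem exists_abs_deriv_eq_three (f : ℝ → ℝ) (hf : Differentiable ℝ f) (h1 : ∀ t, |t| ≤ 1 / 3 → f t = 1)
    (h0 : ∀ t, 2 / 3 ≤ |t| → f t = 0) : ∃ t ∈ Ioo (1 / 3 : ℝ) (2 / 3), |deriv f t| = 3 := by
  obtain ⟨c, hc, hd⟩ := exists_deriv_eq_slope f (by norm_num : (1 / 3 : ℝ) < 2 / 3) hf.continuous.continuousOn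
    (hf.differentiableOn)
  refine ⟨c, hc, ?_⟩
  rw [hd, h0 (2 / 3) (by rw [abs_of_pos (by norm_num)]), h1 (1 / 3) (by rw [abs_of_pos (by norm_num)])]
  norm_num

/-- For every `C¹` profile with the two plateaus, `|ζ′| > 3` somewhere in `(1/3, 2/3)`: otherwise `t ↦ ζ(t) + 3t` is
monotone with equal end values on `[1/3, 2/3]`, so `ζ′ ≡ −3` on `(1/3, 2/3)` and by continuity `ζ′(1/3) = −3`,
contradicting `ζ′(1/3) = 0` (plateau).  So `3 = inf` over profiles of `sup|ζ′|` is not attained.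
[cite: Balaban1987RG1, §3 p.270] (our remark) -/
theorem exists_three_lt_abs_deriv (f : ℝ → ℝ) (hf : ContDiff ℝ 1 f) (h1 : ∀ t, |t| ≤ 1 / 3 → f t = 1)
    (h0 : ∀ t, 2 / 3 ≤ |t| → f t = 0) : ∃ t ∈ Ioo (1 / 3 : ℝ) (2 / 3), 3 < |deriv f t| := by
  by_contra hcon
  simp only [not_exists, not_and, not_lt] at hcon
  have hd : Differentiable ℝ f := hf.differentiable one_ne_zero
  have hcd : Continuous (deriv f) := hf.continuous_deriv le_rfl
  have h3 : ∀ s : ℝ, HasDerivAt (fun s : ℝ => 3 * s) 3 s := fun s => by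
    simpa using (hasDerivAt_id s).const_mul (3 : ℝ)
  -- `g(t) = f(t) + 3t` is monotone on `[1/3, 2/3]`
  have hmono : MonotoneOn (fun t => f t + 3 * t) (Icc (1 / 3 : ℝ) (2 / 3)) := by
    apply monotoneOn_of_deriv_nonneg (convex_Icc _ _)
    · exact (hd.continuous.add (continuous_const.mul continuous_id)).continuousOn
    · exact (hd.add fun s => (h3 s).differentiableAt).differentiableOn
    · intro t ht
      rw [interior_Icc] at ht
      have e : deriv (fun t => f t + 3 * t) t = deriv f t + 3 := ((hd t).hasDerivAt.add (h3 t)).deriv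
      rw [e]
      have := hcon t ht
      rw [abs_le] at this
      linarith [this.1]
  have hconst : ∀ t ∈ Icc (1 / 3 : ℝ) (2 / 3), f t = 2 - 3 * t := by
    intro t ht
    have h1' := hmono (left_mem_Icc.2 (by norm_num)) ht ht.1
    have h2' := hmono ht (right_mem_Icc.2 (by norm_num)) ht.2
    simp only at h1' h2'
    rw [h1 (1 / 3) (by rw [abs_of_pos (by norm_num)])] at h1'
    rw [h0 (2 / 3) (by rw [abs_of_pos (by norm_num)])] at h2'
    linarith
  -- so `f′ = −3` on the open interval
  have hder : ∀ t ∈ Ioo (1 / 3 : ℝ) (2 / 3), deriv f t = -3 := by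
    intro t ht
    have hev : f =ᶠ[𝓝 t] fun s => 2 - 3 * s :=
      Filter.eventually_of_mem (Ioo_mem_nhds ht.1 ht.2) fun s hs => hconst s (Ioo_subset_Icc_self hs)
    rw [hev.deriv_eq, ((h3 t).const_sub 2).deriv]
  -- continuity of `f′` at `1/3` from the right forces `f′(1/3) = −3`
  have hlim : Tendsto (deriv f) (𝓝[>] (1 / 3)) (𝓝 (deriv f (1 / 3))) :=
    hcd.continuousAt.continuousWithinAt.tendsto
  have hlim2 : Tendsto (deriv f) (𝓝[>] (1 / 3)) (𝓝 (-3)) := by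
    refine (tendsto_const_nhds (x := (-3 : ℝ))).congr' ?_
    exact Filter.eventually_of_mem (Ioo_mem_nhdsGT (by norm_num : (1 / 3 : ℝ) < 2 / 3))
      fun s hs => (hder s hs).symm
  have heq : deriv f (1 / 3) = -3 := tendsto_nhds_unique hlim hlim2
  -- but the plateau gives `f′(1/3) = 0`
  have h13 : deriv f (1 / 3) = 0 :=
    B12PartitionUnity270.deriv_eq_zero_of_const_Icc_right hd (by norm_num : (-(1 / 3) : ℝ) < 1 / 3)
      fun t ht => h1 t (abs_le.2 ⟨by linarith [ht.1], ht.2⟩)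
  linarith

/-! ## §5  The (3.31) cut-off constants of `B12Ineq331Cutoff`, explicit -/

/-- **The constants of `B12Ineq331Cutoff.zeta_profile_constants`, EXPLICIT: `D = 6`, `D₂ = 144`** — `ζ` has a
derivative everywhere, `|ζ′| ≤ 6`, `ζ` is `6`-Lipschitz and `ζ′` is `144`-Lipschitz.
[cite: Balaban1987RG1, §3 p.270] (corrected constants for the profile of record; our computation) -/
theorem zeta_profile_constants_explicit :
    (∀ s, HasDerivAt zeta (deriv zeta s) s) ∧
    (∀ s, |deriv zeta s| ≤ 6) ∧
    (∀ s s', |zeta s - zeta s'| ≤ 6 * |s - s'|) ∧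
    (∀ s s', |deriv zeta s - deriv zeta s'| ≤ 144 * |s - s'|) := by
  have hdiff : Differentiable ℝ zeta := fun s => (hasDerivAt_zeta s).differentiableAt
  have hdiff' : Differentiable ℝ (deriv zeta) := fun s => (hasDerivAt_deriv_zeta s).differentiableAt
  refine ⟨fun s => (hdiff s).hasDerivAt, abs_deriv_zeta_le, fun s s' => ?_, fun s s' => ?_⟩
  · have h := convex_univ.norm_image_sub_le_of_norm_deriv_le (f := zeta) (fun x _ => hdiff x)
      (fun x _ => by simpa [Real.norm_eq_abs] using abs_deriv_zeta_le x) (Set.mem_univ s') (Set.mem_univ s)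
    simpa [Real.norm_eq_abs] using h
  · have h := convex_univ.norm_image_sub_le_of_norm_deriv_le (f := deriv zeta) (fun x _ => hdiff' x)
      (fun x _ => by simpa [Real.norm_eq_abs] using abs_deriv2_zeta_le x) (Set.mem_univ s') (Set.mem_univ s)
    simpa [Real.norm_eq_abs] using h

/-- `0 ≤ ζ ≤ 1`, packaged. [cite: Balaban1987RG1, §3 p.270] -/
theorem zeta_mem01 (s : ℝ) : 0 ≤ zeta s ∧ zeta s ≤ 1 := ⟨zeta_nonneg s, zeta_le_one s⟩

/-- **`|ζ_□(x) − ζ_□(x′)| ≤ 6M⁻¹|x − x′|₁`** for the cut-off `ζ_□(x) = Π_μ ζ(M⁻¹(x_μ − y_μ))` on the profile of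
record — the printed «O(1)M⁻¹» of p. 272 with `O(1) = 6`. [cite: Balaban1987RG1, (3.31) p.276] (our computation) -/
theorem abs_zetaCube_sub_le {d : ℕ} {M : ℝ} (hM : 0 < M) (y x x' : Fin d → ℝ) :
    |cubeCutoff zeta M y x - cubeCutoff zeta M y x'| ≤ M⁻¹ * 6 * l1 x x' :=
  B12Ineq331Cutoff.abs_cubeCutoff_sub_le zeta_mem01 zeta_profile_constants_explicit.2.2.1 hM y x x'

/-- **`|∇^η_νζ_□| ≤ 6M⁻¹`.** [cite: Balaban1987RG1, (3.31) p.276] (our computation) -/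
theorem abs_gradZetaCube_le {d : ℕ} {M : ℝ} (hM : 0 < M) {η : ℝ} (hη : η ≠ 0) (y : Fin d → ℝ) (ν : Fin d)
    (x : Fin d → ℝ) : |gradCube zeta M y ν η x| ≤ M⁻¹ * 6 :=
  B12Ineq331Cutoff.abs_gradCube_le zeta_mem01 zeta_profile_constants_explicit.2.2.1 hM hη y ν x

/-- **`|∇_νζ_□(x) − ∇_νζ_□(x′)| ≤ 180M⁻²|x − x′|₁`** (`180 = 144 + 6²`) — the printed «O(1)M⁻²» with `O(1) = 180`.
[cite: Balaban1987RG1, (3.31) p.276] (our computation) -/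
theorem abs_gradZetaCube_sub_le {d : ℕ} {M : ℝ} (hM : 0 < M) {η : ℝ} (hη : η ≠ 0) (y : Fin d → ℝ) (ν : Fin d)
    (x x' : Fin d → ℝ) : |gradCube zeta M y ν η x - gradCube zeta M y ν η x'| ≤ M⁻¹ ^ 2 * 180 * l1 x x' := by
  have h := B12Ineq331Cutoff.abs_gradCube_sub_le zeta_mem01 zeta_profile_constants_explicit.2.2.1
    zeta_profile_constants_explicit.1 zeta_profile_constants_explicit.2.2.2 hM (by norm_num) (by norm_num) hη
    y ν x x'
  rw [inv_pow]
  norm_num at h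
  exact h

end

end Literature.MathematicalPhysics.QuantumFieldTheory.Balaban1983to89.B12Profile270Bounds
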